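import Mathlib.Algebra.Order.BigOperators.Group.Finset
import Mathlib.Algebra.BigOperators.Fin
import Mathlib.Data.Fintype.Fin
import Mathlib.Order.Monotone.Basic
import Mathlib.Tactic.Ring
import HarnessLib

/-!
# Interlacing of integer partitions from the truncated-size equations

Topic `NumberTheory/Automorphic` (combinatorial lemma for `SphericalXiEstimateGL`); theorems only.
Pure combinatorics of antitone tuples `ν : Fin n → ℕ` ("partitions with `n` parts") and
`Λ : Fin (n+1) → ℕ`: the *truncated sizes* `h_k(a) = ∑_i min(a_i, k)` (`= |A/ϖ^k A|` for a finite
module `A` of type `a` over a discrete valuation ring, Macdonald, *Symmetric functions and Hall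
polynomials* (1995), Ch. II, (1.6)), their increments `h_{k+1}(a) - h_k(a) = #{i : a_i ≥ k+1}`
(the conjugate partition, `truncSize_succ`), and the following statement.

**Theorem** (`le_castSucc_of_truncSize_eq`, `succ_le_of_truncSize_eq`, `sum_exp_add_weight_eq`). Let `D : ℕ → ℕ` satisfy
`h_k(Λ) + D_k = h_k(ν) + k` for all `k` and `D_k ≤ D_{k+1} ≤ D_k + 1`. Then
* `ν` and `Λ` **interlace**: `Λ_{i+1} ≤ ν_i ≤ Λ_i` (`λ/ν` is a horizontal strip — the conjugate
  partitions differ by `0` or `1`, Macdonald (1995), Ch. I, §1 and Ch. II, (4.3));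
* `∑_{i<n} D_{ν_i} + n(Λ) = |ν| + n(ν)`, where `n(a) = ∑_i i a_i` (`0`-indexed) and `|ν| = ∑ ν_i`
  (from `∑_{i,i'} min(ν_{i'}, ν_i) = |ν| + 2 n(ν)` and, by interlacing,
  `∑_{i<n, i'≤n} min(Λ_{i'}, ν_i) = |ν| + n(ν) + n(Λ)`).
These are the exponent identities behind the bound `q^{|ν| + n(ν) - n(λ)}` for the number of
extension classes in the last-column recursion for lattices in `𝒪^{n+1}` (the coefficientwise
bound `ψ_{λ/ν}(t) ≤ 1`, `0 ≤ t ≤ 1`, in Macdonald's tableau formula for the Hall–Littlewood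
polynomials, Ch. III, (5.8')–(5.11'), is the same numerology).

## References

* I. G. Macdonald, *Symmetric functions and Hall polynomials*, 2nd ed. (1995), Ch. II, (1.6), (4.3)
  [Macdonald1995].
-/

open Finset

namespace Literature.NumberTheory.Automorphic

namespace Interlacing

/-! ### Truncated sizes and their increments -/

/-- The truncated size `h_k(a) = ∑_i min(a_i, k)`. [folklore] -/
def truncSize {N : ℕ} (a : Fin N → ℕ) (k : ℕ) : ℕ := ∑ i, min (a i) k

/-- The number of parts `≥ k`: `#{i : k ≤ a_i}` (the conjugate partition at `k`). [folklore] -/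
def countGe {N : ℕ} (a : Fin N → ℕ) (k : ℕ) : ℕ := #{i : Fin N | k ≤ a i}

/-- `h_0 = 0`. [folklore] -/
@[simp]
theorem truncSize_zero {N : ℕ} (a : Fin N → ℕ) : truncSize a 0 = 0 := by
  simp [truncSize]

/-- `h_{k+1}(a) = h_k(a) + #{i : a_i ≥ k+1}`. [folklore] -/
theorem truncSize_succ {N : ℕ} (a : Fin N → ℕ) (k : ℕ) :
    truncSize a (k + 1) = truncSize a k + countGe a (k + 1) := by
  rw [truncSize, truncSize, countGe, Finset.card_filter, ← Finset.sum_add_distrib]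
  refine Finset.sum_congr rfl fun i _ => ?_
  by_cases h : k + 1 ≤ a i
  · rw [if_pos h, min_eq_right h, min_eq_right (by omega)]
  · rw [if_neg h, min_eq_left (by omega), min_eq_left (by omega), add_zero]

/-- For an antitone tuple, `#{i : k ≤ a_i} ≤ j` as soon as `a_j < k` (`j < N`). [folklore] -/
theorem countGe_le_of_lt {N : ℕ} {a : Fin N → ℕ} (ha : Antitone a) {k : ℕ} (j : Fin N)
    (hj : a j < k) : countGe a k ≤ j := by
  rw [countGe]
  calc #{i : Fin N | k ≤ a i} ≤ #{i : Fin N | (i : ℕ) < j} := by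
        refine Finset.card_le_card fun i hi => ?_
        rw [Finset.mem_filter] at hi ⊢
        refine ⟨Finset.mem_univ _, ?_⟩
        by_contra hij
        exact absurd (hi.2.trans (ha (Fin.le_def.2 (not_lt.1 hij)))) (not_le.2 hj)
    _ = min N j := Fin.card_filter_val_lt
    _ ≤ j := min_le_right _ _

/-- For an antitone tuple, `j + 1 ≤ #{i : k ≤ a_i}` as soon as `k ≤ a_j`. [folklore] -/
theorem succ_le_countGe_of_le {N : ℕ} {a : Fin N → ℕ} (ha : Antitone a) {k : ℕ} (j : Fin N)
    (hj : k ≤ a j) : (j : ℕ) + 1 ≤ countGe a k := by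
  rw [countGe]
  calc (j : ℕ) + 1 = min N ((j : ℕ) + 1) := by rw [min_eq_right j.is_lt]
    _ = #{i : Fin N | (i : ℕ) < (j : ℕ) + 1} := Fin.card_filter_val_lt.symm
    _ ≤ #{i : Fin N | k ≤ a i} := by
        refine Finset.card_le_card fun i hi => ?_
        rw [Finset.mem_filter] at hi ⊢
        exact ⟨Finset.mem_univ _, hj.trans (ha (Fin.le_def.2 (by omega)))⟩

/-! ### Interlacing -/

variable {n : ℕ} {ν : Fin n → ℕ} {Λ : Fin (n + 1) → ℕ} {D : ℕ → ℕ}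

/-- **The conjugate partitions differ by `0` or `1`**: under the truncated-size equations,
`#{i : ν_i ≥ k} ≤ #{i : Λ_i ≥ k} ≤ #{i : ν_i ≥ k} + 1` for `k ≥ 1`. [folklore] -/
theorem countGe_le_and_le (hD : ∀ k, truncSize Λ k + D k = truncSize ν k + k)
    (hmono : ∀ k, D k ≤ D (k + 1)) (hsucc : ∀ k, D (k + 1) ≤ D k + 1) (k : ℕ) :
    countGe ν (k + 1) ≤ countGe Λ (k + 1) ∧ countGe Λ (k + 1) ≤ countGe ν (k + 1) + 1 := by
  have h0 := hD k
  have h1 := hD (k + 1)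
  rw [truncSize_succ, truncSize_succ] at h1
  have := hmono k
  have := hsucc k
  omega

/-- **Interlacing, upper half**: `ν_i ≤ Λ_i`. [folklore] -/
theorem le_castSucc_of_truncSize_eq (hν : Antitone ν) (hΛ : Antitone Λ)
    (hD : ∀ k, truncSize Λ k + D k = truncSize ν k + k)
    (hmono : ∀ k, D k ≤ D (k + 1)) (hsucc : ∀ k, D (k + 1) ≤ D k + 1) (i : Fin n) :
    ν i ≤ Λ i.castSucc := by
  by_contra hlt
  rw [not_le] at hlt
  -- `k = ν_i ≥ 1`; `#{ν ≥ k} ≥ i + 1` but `#{Λ ≥ k} ≤ i`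
  obtain ⟨k, hk⟩ : ∃ k, ν i = k + 1 := ⟨ν i - 1, by omega⟩
  have h1 := succ_le_countGe_of_le hν i (le_of_eq hk.symm)
  have h2 := countGe_le_of_lt hΛ i.castSucc (hk ▸ hlt)
  rw [Fin.val_castSucc] at h2
  have h3 := (countGe_le_and_le hD hmono hsucc k).1
  omega

/-- **Interlacing, lower half**: `Λ_{i+1} ≤ ν_i`. [folklore] -/
theorem succ_le_of_truncSize_eq (hν : Antitone ν) (hΛ : Antitone Λ)
    (hD : ∀ k, truncSize Λ k + D k = truncSize ν k + k)
    (hmono : ∀ k, D k ≤ D (k + 1)) (hsucc : ∀ k, D (k + 1) ≤ D k + 1) (i : Fin n) :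
    Λ i.succ ≤ ν i := by
  by_contra hlt
  rw [not_le] at hlt
  obtain ⟨k, hk⟩ : ∃ k, Λ i.succ = k + 1 := ⟨Λ i.succ - 1, by omega⟩
  have h1 := succ_le_countGe_of_le hΛ i.succ (le_of_eq hk.symm)
  have h2 := countGe_le_of_lt hν i (hk ▸ hlt)
  rw [Fin.val_succ] at h1
  have h3 := (countGe_le_and_le hD hmono hsucc k).2
  omega

/-! ### The exponent identity -/

/-- `∑_{i ∈ Fin M} ∑_{i' ∈ Fin N, i < i'} f(i') = ∑_{i'} min(M, i') f(i')`. [folklore] -/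
theorem sum_sum_filter_lt {M N : ℕ} (f : Fin N → ℕ) :
    ∑ i : Fin M, ∑ i' ∈ Finset.univ.filter (fun i' : Fin N => (i : ℕ) < i'), f i' =
      ∑ i' : Fin N, min M i' * f i' := by
  have h : ∀ i : Fin M, ∑ i' ∈ Finset.univ.filter (fun i' : Fin N => (i : ℕ) < i'), f i' =
      ∑ i' : Fin N, if (i : ℕ) < i' then f i' else 0 := fun i => by rw [Finset.sum_filter]
  simp_rw [h]
  rw [Finset.sum_comm]
  refine Finset.sum_congr rfl fun i' _ => ?_
  rw [← Finset.sum_filter, Finset.sum_const, smul_eq_mul, Fin.card_filter_val_lt]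

/-- `∑_{i'} min(a_{i'}, c) = (i+1) c + ∑_{i' > i} a_{i'}` when `a_{i'} ≥ c` for `i' ≤ i` and
`a_{i'} ≤ c` for `i' > i`. [folklore] -/
theorem sum_min_eq_of_threshold {N : ℕ} (a : Fin N → ℕ) (c : ℕ) (j : ℕ) (hj : j < N)
    (hle : ∀ i' : Fin N, (i' : ℕ) ≤ j → c ≤ a i') (hge : ∀ i' : Fin N, j < i' → a i' ≤ c) :
    ∑ i', min (a i') c =
      (j + 1) * c + ∑ i' ∈ Finset.univ.filter (fun i' : Fin N => j < (i' : ℕ)), a i' := by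
  rw [← Finset.sum_filter_add_sum_filter_not Finset.univ (fun i' : Fin N => (i' : ℕ) < j + 1)]
  congr 1
  · rw [Finset.sum_congr rfl (fun i' hi' => show min (a i') c = c from
      min_eq_right (hle i' (by rw [Finset.mem_filter] at hi'; omega))), Finset.sum_const, smul_eq_mul,
      Fin.card_filter_val_lt, min_eq_right (by omega)]
  · have hs : Finset.univ.filter (fun i' : Fin N => ¬((i' : ℕ) < j + 1)) =
        Finset.univ.filter (fun i' : Fin N => j < (i' : ℕ)) := by
      ext i'; simp only [Finset.mem_filter, Finset.mem_univ, true_and]; omega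
    rw [hs]
    exact Finset.sum_congr rfl fun i' hi' => min_eq_left (hge i' (by
      rw [Finset.mem_filter] at hi'; exact hi'.2))

/-- The weight `n(a) = ∑_i i a_i` (`0`-indexed parts). [folklore] -/
def weight {N : ℕ} (a : Fin N → ℕ) : ℕ := ∑ i : Fin N, (i : ℕ) * a i

/-- `∑_{i,i'} min(ν_{i'}, ν_i) = |ν| + 2 n(ν)` for antitone `ν`. [folklore] -/
theorem sum_sum_min_self (hν : Antitone ν) :
    ∑ i, ∑ i', min (ν i') (ν i) = ∑ i, ν i + 2 * weight ν := by
  have h : ∀ i : Fin n, ∑ i', min (ν i') (ν i) =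
      ((i : ℕ) + 1) * ν i + ∑ i' ∈ Finset.univ.filter (fun i' : Fin n => (i : ℕ) < i'), ν i' :=
    fun i => sum_min_eq_of_threshold ν (ν i) i i.is_lt (fun i' h => hν (Fin.le_def.2 h))
      (fun i' h => hν (Fin.le_def.2 h.le))
  rw [Finset.sum_congr rfl fun i _ => h i, Finset.sum_add_distrib, sum_sum_filter_lt, weight]
  have e1 : ∑ i : Fin n, ((i : ℕ) + 1) * ν i = ∑ i, ν i + ∑ i : Fin n, (i : ℕ) * ν i := by
    rw [← Finset.sum_add_distrib]
    exact Finset.sum_congr rfl fun i _ => by ring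
  have e2 : ∑ i : Fin n, min n (i : ℕ) * ν i = ∑ i : Fin n, (i : ℕ) * ν i :=
    Finset.sum_congr rfl fun i _ => by rw [min_eq_right i.is_lt.le]
  rw [e1, e2]
  ring

/-- `∑_{i<n} ∑_{i'≤n} min(Λ_{i'}, ν_i) = |ν| + n(ν) + n(Λ)` for interlacing `ν`, `Λ`. [folklore] -/
theorem sum_sum_min_of_interlace (hΛ : Antitone Λ)
    (hup : ∀ i : Fin n, ν i ≤ Λ i.castSucc) (hlow : ∀ i : Fin n, Λ i.succ ≤ ν i) :
    ∑ i : Fin n, ∑ i' : Fin (n + 1), min (Λ i') (ν i) = ∑ i, ν i + weight ν + weight Λ := by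
  have h : ∀ i : Fin n, ∑ i' : Fin (n + 1), min (Λ i') (ν i) =
      ((i : ℕ) + 1) * ν i + ∑ i' ∈ Finset.univ.filter (fun i' : Fin (n + 1) => (i : ℕ) < i'), Λ i' := by
    intro i
    refine sum_min_eq_of_threshold Λ (ν i) i (Nat.lt_succ_of_lt i.is_lt) (fun i' h => ?_) (fun i' h => ?_)
    · exact (hup i).trans (hΛ (Fin.le_def.2 (by rw [Fin.val_castSucc]; exact h)))
    · exact (hΛ (Fin.le_def.2 (by rw [Fin.val_succ]; omega))).trans (hlow i)
  rw [Finset.sum_congr rfl fun i _ => h i, Finset.sum_add_distrib, sum_sum_filter_lt, weight, weight]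
  have e1 : ∑ i : Fin n, ((i : ℕ) + 1) * ν i = ∑ i, ν i + ∑ i : Fin n, (i : ℕ) * ν i := by
    rw [← Finset.sum_add_distrib]
    exact Finset.sum_congr rfl fun i _ => by ring
  have e3 : ∑ i' : Fin (n + 1), min n (i' : ℕ) * Λ i' = ∑ i' : Fin (n + 1), (i' : ℕ) * Λ i' :=
    Finset.sum_congr rfl fun i' _ => by rw [min_eq_right (Nat.lt_succ_iff.1 i'.is_lt)]
  rw [e1, e3]

/-- **The exponent identity.** Under the truncated-size equations with `D_k ≤ D_{k+1} ≤ D_k + 1`: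
`∑_{i<n} D_{ν_i} + n(Λ) = |ν| + n(ν)`. [folklore] -/
theorem sum_exp_add_weight_eq (hν : Antitone ν) (hΛ : Antitone Λ)
    (hD : ∀ k, truncSize Λ k + D k = truncSize ν k + k)
    (hmono : ∀ k, D k ≤ D (k + 1)) (hsucc : ∀ k, D (k + 1) ≤ D k + 1) :
    ∑ i, D (ν i) + weight Λ = ∑ i, ν i + weight ν := by
  have hup := le_castSucc_of_truncSize_eq hν hΛ hD hmono hsucc
  have hlow := succ_le_of_truncSize_eq hν hΛ hD hmono hsucc
  -- sum the equations at `k = ν_i`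
  have hsum : ∑ i, (truncSize Λ (ν i) + D (ν i)) = ∑ i, (truncSize ν (ν i) + ν i) :=
    Finset.sum_congr rfl fun i _ => hD (ν i)
  rw [Finset.sum_add_distrib, Finset.sum_add_distrib] at hsum
  have hA : ∑ i, truncSize Λ (ν i) = ∑ i, ν i + weight ν + weight Λ :=
    sum_sum_min_of_interlace hΛ hup hlow
  have hB : ∑ i, truncSize ν (ν i) = ∑ i, ν i + 2 * weight ν := sum_sum_min_self hν
  rw [hA, hB] at hsum
  omega

/-- **Summary** in the form used by `SphericalXiEstimateGL`: interlacing bounds and the exponent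
inequality `∑_i min(ν_i, D_{ν_i}) + n(Λ) ≤ |ν| + n(ν)`. [folklore] -/
theorem sum_min_exp_add_weight_le (hν : Antitone ν) (hΛ : Antitone Λ)
    (hD : ∀ k, truncSize Λ k + D k = truncSize ν k + k)
    (hmono : ∀ k, D k ≤ D (k + 1)) (hsucc : ∀ k, D (k + 1) ≤ D k + 1) :
    ∑ i, min (ν i) (D (ν i)) + weight Λ ≤ ∑ i, ν i + weight ν := by
  rw [← sum_exp_add_weight_eq hν hΛ hD hmono hsucc]
  exact Nat.add_le_add_right (Finset.sum_le_sum fun i _ => min_le_right _ _) _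

/-- The largest part of `Λ` bounds the parts of `ν`: `ν_i ≤ Λ_0` (for `n ≥ 1`). [folklore] -/
theorem le_apply_zero_of_truncSize_eq (hν : Antitone ν) (hΛ : Antitone Λ)
    (hD : ∀ k, truncSize Λ k + D k = truncSize ν k + k)
    (hmono : ∀ k, D k ≤ D (k + 1)) (hsucc : ∀ k, D (k + 1) ≤ D k + 1) (i : Fin n) :
    ν i ≤ Λ 0 :=
  (le_castSucc_of_truncSize_eq hν hΛ hD hmono hsucc i).trans (hΛ (Fin.zero_le _))

end Interlacing

end Literature.NumberTheory.Automorphic
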